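import Mathlib
import Summits.NavierStokesRegularity.NavierStokesRegularity.Theorems.HeteroclinicTriggerChainTriggerChainFrontStepLatticeDelay
import Summits.NavierStokesRegularity.NavierStokesRegularity.Theorems.HeteroclinicTriggerChainTriggerChainFrontStepForcedHop
import HarnessLib

/-!
# `HeteroclinicTriggerChain` — crux `TriggerChainFrontStep` (item stmt-NavierStokesRegularity-22785):
  ONE HOP ON THE LATTICE — ignition and exponential transfer of an exact flow of the pinned table

Headline composition of the width-seat bricks for line `gapdata_v2` (DYN-STEP modulo envelope supply).
For an EXACT lattice flow `S` of `α₀ + βσ` on `[0,T]` (`α₀` in normal form at `i₀`, parity at `i₁`,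
`g = e = d i₁ 0 > 0`, `|α₀| ≤ 1`; one-sided derivatives on the window) with envelopes on the window —
junk `ι`, upper trigger `V`, wake trigger `ω`, the three `σ`-rows `B_σ`, front block `M` — the front
block `D = S_{i₀,0} − S_{i₀,1}`, `u = S_{i₁,0}` is a forced arc with
`φ₁ = 40ι² + 2ω² + 16V² + 2βB_σ`, `φ₂ = 8Mι + 4Vι + 4ωι + βB_σ` (`…LatticeDelay`), and the composed
forced-arc hop (`…ForcedHop`) yields (`htcLH_lattice_hop`): a first IGNITION time `τ ≤ T₁` (delay law
with the sub-threshold seed `S_{i₁,0}(0)`), then the crossing of equal split by `τ + D₊/(2em − φ)` and the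
EXPONENTIAL capture `S_{i₀,0} − S_{i₀,1} + ρ₋ ≤ ρ₋e^{−eρ₋(t−t₀)} + φ/(eρ₋)` until the end of the window.
The smallness hypotheses are those of the two forced-arc compositions, with `φ = φ₁ + φ₂`; the crux
note `Cruxes/TriggerChainFrontStep/DESIGN-NOTE-p5.md` §6 records why they hold as `β → 0` in the
junk-free class.

HONEST FRAMING: a statement about exact flows of Tao-type MODEL lattices (Tao 2016 §4) under envelope
hypotheses that the line must supply (tail/wake/junk control, bootstrap); helper for the crux (no stub
credit); nothing here is a statement about the Navier–Stokes equations; no summit, rung or crux is proved.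
-/

noncomputable section

set_option linter.dupNamespace false

open Real Set

namespace Summit.NavierStokesRegularity.NavierStokesRegularity.Theorems

open Literature.Analysis.FluidPDE Literature.Analysis.FluidPDE.TaoCascade

/-- **ONE HOP ON THE LATTICE.** See the module docstring. [this file] -/
theorem htcLH_lattice_hop (α₀ σ : Fin 4 → Fin 4 → Fin 4 → ℤ × ℤ × ℤ → ℝ) (i₀ i₁ : Fin 4)
    (d : Fin 4 → ℤ → ℝ) (hne : i₀ ≠ i₁)
    (hsym : IsSymmetricCoeff α₀) (hcanc : IsCancellingCoeff α₀)
    (hpure : ∀ X : Fin 4 → ℤ → ℝ → ℝ, (∀ i n t, i ≠ i₀ → X i n t = 0) →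
      ∀ i n t, quadTerm 1 α₀ X i n t = 0)
    (hsad : ∀ (Y : Fin 4 → ℤ → ℝ → ℝ) (i : Fin 4) (n : ℤ) (t : ℝ),
      quadTerm 1 α₀ (fun j m s => (fun j m (_ : ℝ) => if j = i₀ ∧ m = 0 then (1 : ℝ) else 0) j m s +
          Y j m s) i n t -
        quadTerm 1 α₀ (fun j m (_ : ℝ) => if j = i₀ ∧ m = 0 then (1 : ℝ) else 0) i n t -
        quadTerm 1 α₀ Y i n t = d i n * Y i n t)
    (hpar : ∀ (j₁ j₂ j₃ : Fin 4) (μ : ℤ × ℤ × ℤ),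
      Xor (Xor (j₁ = i₁) (j₂ = i₁)) (j₃ = i₁) → α₀ j₁ j₂ j₃ μ = 0)
    (hα1 : ∀ a b c μ, |α₀ a b c μ| ≤ 1)
    (hg : α₀ i₁ i₁ i₀ (0, 0, 1) = d i₁ 0) (he : 0 < d i₁ 0)
    (β : ℝ) (hβ : 0 ≤ β) (S : Fin 4 → ℤ → ℝ → ℝ) {T T₁ : ℝ} (hT₁ : 0 ≤ T₁) (hT₁T : T₁ ≤ T)
    (hS : ∀ i k, ∀ t ∈ Icc 0 T, HasDerivWithinAt (S i k)
      (quadTerm 1 α₀ S i k t + β * quadTerm 1 σ S i k t) (Icc 0 T) t)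
    {M V ι ω Bσ : ℝ} (hι0 : 0 ≤ ι)
    (hM : ∀ t ∈ Icc 0 T, |S i₀ 0 t - S i₀ 1 t| ≤ M ∧ |S i₁ 0 t| ≤ M)
    (hV : ∀ t ∈ Icc 0 T, |S i₁ 1 t| ≤ V) (hω : ∀ t ∈ Icc 0 T, |S i₁ (-1) t| ≤ ω)
    (hι : ∀ t ∈ Icc 0 T, ∀ a, a ≠ i₀ → a ≠ i₁ → |S a 0 t| ≤ ι ∧ |S a 1 t| ≤ ι ∧ |S a (-1) t| ≤ ι)
    (hBσ : ∀ t ∈ Icc 0 T, |quadTerm 1 σ S i₀ 0 t| ≤ Bσ ∧ |quadTerm 1 σ S i₀ 1 t| ≤ Bσ ∧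
      |quadTerm 1 σ S i₁ 0 t| ≤ Bσ)
    {φ₁ φ₂ φ h Dm Dp ρ₀ ρm Mf m : ℝ}
    (hφ₁ : φ₁ = 40 * ι ^ 2 + 2 * ω ^ 2 + 16 * V ^ 2 + 2 * β * Bσ)
    (hφ₂ : φ₂ = 8 * M * ι + 4 * V * ι + 4 * ω * ι + β * Bσ) (hφ : φ = φ₁ + φ₂)
    -- delay data
    (hDm : 0 < Dm) (hDmle : Dm ≤ (S i₀ 0 0 - S i₀ 1 0) - (2 * d i₁ 0 * h ^ 2 + φ₁) * T)
    (hDp : (S i₀ 0 0 - S i₀ 1 0) + φ₁ * T ≤ Dp)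
    (hfl : φ₂ / (d i₁ 0 * Dm) < S i₁ 0 0) (huh0 : |S i₁ 0 0| < h)
    (hreach : h ≤ (S i₁ 0 0 - φ₂ / (d i₁ 0 * Dm)) * Real.exp (d i₁ 0 * Dm * T₁))
    -- transfer data
    (hρ₀ : 0 ≤ ρ₀) (hρ₀ge : Dp ^ 2 + 2 * h ^ 2 ≤ ρ₀ ^ 2) (hMf : Mf = ρ₀ + Real.sqrt 3 * φ * T)
    (hφm : φ < 2 * d i₁ 0 * m) (hm : 2 * m + 6 * Mf * φ * T ≤ 2 * h ^ 2)
    (hTw : T₁ + Dp / (2 * d i₁ 0 * m - φ) ≤ T)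
    (hρm : 0 < ρm) (hρmQ : ρm ^ 2 + 6 * Mf * φ * T ≤ Dm ^ 2 + 2 * h ^ 2)
    (hφρ : φ < d i₁ 0 * ρm ^ 2) :
    ∃ τ ∈ Ioc 0 T₁, S i₁ 0 τ = h ∧ (∀ t ∈ Ico 0 τ, |S i₁ 0 t| < h) ∧
      ∃ t₀ ∈ Icc τ (τ + max 0 (Dp / (2 * d i₁ 0 * m - φ))), S i₀ 0 t₀ - S i₀ 1 t₀ ≤ 0 ∧
        ∀ t ∈ Icc t₀ T, S i₀ 0 t - S i₀ 1 t ≤ 0 ∧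
          S i₀ 0 t - S i₀ 1 t + ρm ≤ ρm * Real.exp (-(d i₁ 0 * ρm * (t - t₀))) + φ / (d i₁ 0 * ρm) := by
  obtain ⟨f₁, f₂, hD, hu, hf₁, hf₂⟩ := htcLD_front_block_forced₂ α₀ σ i₀ i₁ d hne hsym hcanc hpure
    hsad hpar hα1 hg he β hβ S hS hι0 hM hV hω hι hBσ
  have hT : 0 ≤ T := hT₁.trans hT₁T
  have hV0 : 0 ≤ V := (abs_nonneg _).trans (hV 0 ⟨le_rfl, hT⟩)
  have hω0 : 0 ≤ ω := (abs_nonneg _).trans (hω 0 ⟨le_rfl, hT⟩)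
  have hM0 : 0 ≤ M := (abs_nonneg _).trans (hM 0 ⟨le_rfl, hT⟩).2
  have hB0 : 0 ≤ Bσ := (abs_nonneg _).trans (hBσ 0 ⟨le_rfl, hT⟩).1
  have hf₁' : ∀ t ∈ Icc 0 T, |f₁ t| ≤ φ₁ := fun t ht => by rw [hφ₁]; exact hf₁ t ht
  have hf₂' : ∀ t ∈ Icc 0 T, |f₂ t| ≤ φ₂ := fun t ht => by rw [hφ₂]; exact hf₂ t ht
  have hφ₁φ : φ₁ ≤ φ := by
    rw [hφ, hφ₂]; have : 0 ≤ 8 * M * ι + 4 * V * ι + 4 * ω * ι + β * Bσ := by positivity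
    linarith
  have hφ₂φ : φ₂ ≤ φ := by
    rw [hφ, hφ₁]; have : 0 ≤ 40 * ι ^ 2 + 2 * ω ^ 2 + 16 * V ^ 2 + 2 * β * Bσ := by positivity
    linarith
  exact heteroclinicTriggerChain_forcedArcOn_hop (D := fun t => S i₀ 0 t - S i₀ 1 t) (u := S i₁ 0)
    he hT₁ hT₁T hD hu hf₁' hf₂' hφ₁φ hφ₂φ hDm hDmle hDp hfl huh0 hreach hρ₀ hρ₀ge hMf hφm hm hTw
    hρm hρmQ hφρ

end Summit.NavierStokesRegularity.NavierStokesRegularity.Theorems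

end
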